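import Summits.KontsevichZagierPeriods.KontsevichZagierPeriods.Theorems.LinRedNormalFormArrangementNormalFormSeparateTwoCorner
import Summits.KontsevichZagierPeriods.KontsevichZagierPeriods.Theorems.LinRedNormalFormArrangementNormalFormSeparateTwoRadialLog
import Summits.KontsevichZagierPeriods.KontsevichZagierPeriods.Theorems.LinRedNormalFormArrangementNormalFormSeparateTwoHIOrder
import Summits.KontsevichZagierPeriods.KontsevichZagierPeriods.Theorems.LinRedNormalFormArrangementNormalFormSeparateTwoHIChart

/-!
# The fibre mass along a thin sector: the weight hypotheses of the ray theorems

(Line `janus-bands`, crux `ArrangementNormalForm`, stub `stub_separateTwoPos_hI`, part `HIWeight`.)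
For a literal Janus fibre datum (`lo`, `hi`, `a` over atoms `Atm 2`) and a thin sector at the
base point `z₁` with frame `P, Q` (part `HIChart`), the fibre mass in blown-up coordinates
`Λ'(t, v) = lmass lo hi a (av (bpt z₁ P Q t v))` (parts `Comparison`, `Mass`) satisfies the three
weight hypotheses of the ray theorems (part `HIRayMain`) on all small scales: it is measurable
(`measurable_lmass_bpt`), almost decreasing towards the corner (`hΛmono`, from
`SepTwo.lmass_corner_mono`), and has logarithmic angular and radial costs (`hΛang`, `hΛrad`, from
`SepTwo.lmass_angular_log`, `SepTwo.lmass_radial_log`) — `weight_hyps`, registered in literal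
form as `separateTwo_hiWeight`. The point is that every atom value along the sector is
`av z₁ c + t (p c + q c v)` (`av_bpt`), the format of part `Corner`.
-/

noncomputable section

open Set MeasureTheory
open scoped ENNReal

namespace Summit.KontsevichZagierPeriods.ArrangementNormalForm.JanusBands

namespace SepTwo

variable {k : ℕ}

/-- Atom values along a thin sector. -/
theorem av_bpt (z₁ P Q : Fin 2 → ℝ) (t v : ℝ) (c : Atm 2) :
    av (bpt z₁ P Q t v) c =
      av z₁ c + t * ((∑ i, (c.1 i : ℝ) * P i) + (∑ i, (c.1 i : ℝ) * Q i) * v) := by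
  simp only [av, bpt, Fin.sum_univ_two]
  ring

/-- The finite set of atoms in use. -/
theorem exists_atoms {B : ℕ} (lo hi : Fin k → Fin k ⊕ Atm B) (a : Fin k → Option (Atm B)) :
    ∃ U : Finset (Atm B), (∀ i c, lo i = Sum.inr c → c ∈ U) ∧ (∀ i c, hi i = Sum.inr c → c ∈ U) ∧
      ∀ i c, a i = some c → c ∈ U := by
  classical
  refine ⟨Finset.univ.biUnion fun i =>
    ((lo i).getRight?.toFinset ∪ (hi i).getRight?.toFinset) ∪ (a i).toFinset, ?_, ?_, ?_⟩
  · intro i c h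
    exact Finset.mem_biUnion.2 ⟨i, Finset.mem_univ _, by simp [h]⟩
  · intro i c h
    exact Finset.mem_biUnion.2 ⟨i, Finset.mem_univ _, by simp [h]⟩
  · intro i c h
    exact Finset.mem_biUnion.2 ⟨i, Finset.mem_univ _, by simp [h]⟩

/-- The blow-up point is jointly continuous in `(t, v)`. -/
theorem continuous_bpt (z₁ P Q : Fin 2 → ℝ) :
    Continuous fun p : ℝ × ℝ => bpt z₁ P Q p.1 p.2 := by
  refine continuous_pi fun i => ?_
  simp only [bpt]
  fun_prop

/-- **The fibre mass along a thin sector is measurable.** -/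
theorem measurable_lmass_bpt (lo hi : Fin k → Fin k ⊕ Atm 2) (a : Fin k → Option (Atm 2))
    (z₁ P Q : Fin 2 → ℝ) :
    Measurable (Function.uncurry fun t v => lmass lo hi a (av (bpt z₁ P Q t v))) :=
  (measurable_lmass_av lo hi a).comp (continuous_bpt z₁ P Q).measurable

/-- Splitting the constant of the logarithmic cost. -/
theorem ofReal_five_mul_pow {L : ℝ} (hL : 0 ≤ L) (K : ℕ) :
    ENNReal.ofReal (5 * L) ^ K = ENNReal.ofReal (5 ^ K) * ENNReal.ofReal (L ^ K) := by
  rw [← ENNReal.ofReal_pow (by positivity), mul_pow, ENNReal.ofReal_mul (by positivity)]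

/-- `1 + log (v'/v) ≥ 0` for `0 < v ≤ v'`. -/
theorem one_add_log_nonneg {v v' : ℝ} (hv : 0 < v) (hvv' : v ≤ v') :
    0 ≤ 1 + Real.log (v' / v) := by
  have : 0 ≤ Real.log (v' / v) := Real.log_nonneg ((one_le_div hv).2 hvv')
  linarith

/-- **The weight hypotheses of the ray theorems for the fibre mass along a thin sector.** See
the module docstring. -/
theorem weight_hyps (lo hi : Fin k → Fin k ⊕ Atm 2) (a : Fin k → Option (Atm 2))
    (z₁ P Q : Fin 2 → ℝ) :
    ∃ δ₀ > 0, ∃ ε₀ > 0, ∃ KΛ : ℝ≥0∞, KΛ ≠ ∞ ∧ ∃ Kn : ℕ, ∃ CΛ : ℝ≥0∞, CΛ ≠ ∞ ∧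
      (∀ δ ε : ℝ, 4 * δ ≤ δ₀ → 4 * ε ≤ ε₀ → ∀ x v x' v' : ℝ, 0 < x → x ≤ x' → x' ≤ 4 * x →
        x' < 4 * δ → 0 < v → v ≤ v' → v' ≤ 4 * v → v' < 4 * ε →
        lmass lo hi a (av (bpt z₁ P Q x v)) ≤ KΛ * lmass lo hi a (av (bpt z₁ P Q x' v'))) ∧
      (∀ δ ε : ℝ, δ ≤ δ₀ → ε ≤ ε₀ → ∀ x : ℝ, 0 < x → x < δ → ∀ v v' : ℝ, 0 < v → v ≤ v' →
        v' < ε → lmass lo hi a (av (bpt z₁ P Q x v)) ≤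
          CΛ * ENNReal.ofReal ((1 + Real.log (v' / v)) ^ Kn) * lmass lo hi a (av (bpt z₁ P Q x v'))) ∧
      (∀ δ ε : ℝ, δ ≤ δ₀ → ε ≤ ε₀ → ∀ v : ℝ, 0 < v → v < ε → ∀ x x' : ℝ, 0 < x → x ≤ x' →
        x' < δ → lmass lo hi a (av (bpt z₁ P Q x v)) ≤
          CΛ * ENNReal.ofReal ((1 + Real.log (x' / x)) ^ Kn) * lmass lo hi a (av (bpt z₁ P Q x' v))) := by
  obtain ⟨U, hlo, hhi, ha⟩ := exists_atoms lo hi a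
  set c₀ : Atm 2 → ℝ := fun c => av z₁ c with hc₀
  set p : Atm 2 → ℝ := fun c => ∑ i, (c.1 i : ℝ) * P i with hp
  set q : Atm 2 → ℝ := fun c => ∑ i, (c.1 i : ℝ) * Q i with hq
  have hΛ : ∀ t v, lmass lo hi a (av (bpt z₁ P Q t v)) =
      lmass lo hi a (fun c => c₀ c + t * (p c + q c * v)) := fun t v => by
    congr 1
    funext c
    exact av_bpt z₁ P Q t v c
  obtain ⟨G, hG, hGsep⟩ := exists_sep_const U c₀
  obtain ⟨g, hg, hgsep⟩ := exists_sep_const U p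
  obtain ⟨R, hR, hRp, hRq⟩ := exists_bound_const U p q
  set Kn := k * U.card with hKn
  refine ⟨G / (28 * R), by positivity, min 1 (g / (14 * R)), by positivity,
    (9 : ℝ≥0∞) ^ Kn * (9 : ℝ≥0∞) ^ Kn,
    ENNReal.mul_ne_top (ENNReal.pow_ne_top (by norm_num)) (ENNReal.pow_ne_top (by norm_num)),
    Kn, ENNReal.ofReal (5 ^ Kn), ENNReal.ofReal_ne_top, ?_, ?_, ?_⟩
  · intro δ ε hδ hε x v x' v' hx hxx' hx'x hx' hv hvv' hv'v hv'
    rw [hΛ, hΛ]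
    have hv'1 : v' ≤ 1 := by linarith [min_le_left 1 (g / (14 * R))]
    have hv'g : v' ≤ g / (14 * R) := by linarith [min_le_right 1 (g / (14 * R))]
    exact lmass_corner_mono lo hi a U hlo hhi ha c₀ p q G g R hR hGsep hgsep hRp hRq hx hxx' hx'x
      (by linarith) hv hvv' hv'v hv'1 hv'g
  · intro δ ε hδ hε x hx hxδ v v' hv hvv' hv'
    rw [hΛ, hΛ]
    have hv'1 : v' ≤ 1 := by linarith [min_le_left 1 (g / (14 * R))]
    have hv'g : v' ≤ g / (14 * R) := by linarith [min_le_right 1 (g / (14 * R))]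
    have h := lmass_angular_log lo hi a U hlo hhi ha c₀ p q G g R hR hGsep hgsep hRp hRq hx
      (by linarith) hv hvv' hv'1 hv'g
    rwa [ofReal_five_mul_pow (one_add_log_nonneg hv hvv')] at h
  · intro δ ε hδ hε v hv hvε x x' hx hxx' hx'
    rw [hΛ, hΛ]
    have hv1 : |v| ≤ 1 := by
      rw [abs_of_pos hv]; linarith [min_le_left 1 (g / (14 * R))]
    have h := lmass_radial_log lo hi a U hlo hhi ha c₀ p q G R hR hGsep hRp hRq hx hxx'
      (by linarith) hv1
    rwa [ofReal_five_mul_pow (one_add_log_nonneg hx hxx')] at h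

end SepTwo

/-- **The weight hypotheses of the ray theorems for the fibre mass along a thin sector**
(registered part of `stub_separateTwoPos_hI`; literal form of `SepTwo.weight_hyps`): the fibre
mass of a literal Janus fibre datum at the points `z₁ + x (P + v Q)` of a thin sector is, on all
small scales, almost decreasing towards the corner at scale `4` and has logarithmic angular and
radial costs. -/
theorem separateTwo_hiWeight (k : ℕ) (lo hi : Fin k → Fin k ⊕ ((Fin 2 → ℚ) × ℚ)) (a : Fin k → Option ((Fin 2 → ℚ) × ℚ)) (z₁ P Q : Fin 2 → ℝ) : ∃ δ₀ > 0, ∃ ε₀ > 0, ∃ KΛ : ENNReal, KΛ ≠ ⊤ ∧ ∃ Kn : ℕ, ∃ CΛ : ENNReal, CΛ ≠ ⊤ ∧ (∀ δ ε : ℝ, 4 * δ ≤ δ₀ → 4 * ε ≤ ε₀ → ∀ x v x' v' : ℝ, 0 < x → x ≤ x' → x' ≤ 4 * x → x' < 4 * δ → 0 < v → v ≤ v' → v' ≤ 4 * v → v' < 4 * ε → SepTwo.lmass lo hi a (fun c : (Fin 2 → ℚ) × ℚ => ∑ i, (c.1 i : ℝ) * (z₁ i + x * (P i + v * Q i)) +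 (c.2 : ℝ)) ≤ KΛ * SepTwo.lmass lo hi a (fun c : (Fin 2 → ℚ) × ℚ => ∑ i, (c.1 i : ℝ) * (z₁ i + x' * (P i + v' * Q i)) + (c.2 : ℝ))) ∧ (∀ δ ε : ℝ, δ ≤ δ₀ → ε ≤ ε₀ → ∀ x : ℝ, 0 < x → x < δ → ∀ v v' : ℝ, 0 < v → v ≤ v' → v' < ε → SepTwo.lmass lo hi a (fun c : (Fin 2 → ℚ) × ℚ => ∑ i, (c.1 i : ℝ) * (z₁ i + x * (P i + v * Q i)) + (c.2 : ℝ)) ≤ CΛ * ENNReal.ofReal ((1 + Real.log (v' / v)) ^ Kn) * SepTwo.lmass lo hi a (fun c : (Fin 2 → ℚ) × ℚ => ∑ i, (c.1 i : ℝ) * (z₁ i + x * (P i + v' * Q i)) + (c.2 : ℝ))) ∧ (∀ δ ε : ℝ, δ ≤ δ₀ → ε ≤ ε₀ → ∀ v : ℝ, 0 < v → v < ε → ∀ x x' : ℝ, 0 < x → x ≤ x' → x' < δ → SepTwo.lmass lo hi a (fun c : (Fin 2 → ℚ) × ℚ => ∑ i, (c.1 i : ℝ) * (z₁ i + x * (P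 i + v * Q i)) + (c.2 : ℝ)) ≤ CΛ * ENNReal.ofReal ((1 + Real.log (x' / x)) ^ Kn) * SepTwo.lmass lo hi a (fun c : (Fin 2 → ℚ) × ℚ => ∑ i, (c.1 i : ℝ) * (z₁ i + x' * (P i + v * Q i)) + (c.2 : ℝ))) := by
  exact SepTwo.weight_hyps lo hi a z₁ P Q

end Summit.KontsevichZagierPeriods.ArrangementNormalForm.JanusBands
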